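import Mathlib.Algebra.CubicDiscriminant
import Mathlib.AlgebraicGeometry.EllipticCurve.Weierstrass
import Mathlib.FieldTheory.Finite.GaloisField
import Mathlib.FieldTheory.Galois.Basic
import Mathlib.FieldTheory.SplittingField.Construction
import Mathlib.Data.Nat.Log
import Literature.FieldTheory.FiniteFields.GaussPeriodNormalBases
import HarnessLib

/-!
# Cubics over a finite field of odd characteristic: exactly one root iff the discriminant is a non-square

Topic `FieldTheory/FiniteFields`.  THEOREMS ONLY (nothing is defined, no named fact, no `sorry`).

The classical parity theorem of Stickelberger (1897), in Swan's form [Swan1962, Cor. 1]: for a separable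
polynomial `f` of degree `n` over a finite field of odd characteristic with `r` irreducible factors,
`n ≡ r (mod 2)` iff the discriminant of `f` is a square.  This file proves the CUBIC case, which is all the
arithmetic of `2`-torsion of elliptic curves needs (the `2`-division cubic `4x³ + b₂x² + 2b₄x + b₆` of a
Weierstrass equation has discriminant `16 Δ`, Mathlib `WeierstrassCurve.twoTorsionPolynomial_discr`):

* `card_roots_eq_zero_or_one_or_three` — a cubic `P` over a finite field `K` with `P.a ≠ 0` and
  `P.discr ≠ 0` has `0`, `1` or `3` roots in `K`;
* `card_roots_eq_one_iff_not_isSquare_discr` — **it has exactly one root in `K` iff `P.discr` is not a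
  square in `K`** (`K` of odd characteristic, i.e. `(2 : K) ≠ 0`);
* `isSquare_discr_iff_card_roots`, and the `Nat.card`-of-the-root-set forms
  `natCard_roots_eq_one_iff_not_isSquare_discr`, `log_two_natCard_roots_add_one_mod_two_eq_one_iff` and
  `WeierstrassCurve.log_two_natCard_twoTorsionPolynomial_roots_add_one_mod_two_eq_one_iff` (the parity of
  `log₂ (1 + #roots)`, the local `2`-torsion dimension `dim_{𝔽₂} E(𝔽_ℓ)[2]` of an elliptic curve, is `1`
  iff `Δ` is a non-square).

Proof (Galois theory of finite fields, all in Mathlib): over a splitting field `L ⊇ K` the three roots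
`x, y, z` are distinct and permuted by the Frobenius `φ = Frob_K ∈ Gal(L/K)`
(`FiniteField.frobeniusAlgEquivOfAlgebraic`), whose fixed field is `K` (`IsGalois.fixedField_top`, the
Galois group being generated by `φ`); the `K`-rational roots are the `φ`-fixed ones, so their number is the
number of fixed points of a permutation of three letters: `3` (identity), `0` (a `3`-cycle) or `1`
(a transposition).  With `δ = (x - y)(x - z)(y - z)` one has `discr P = (a² δ)²` in `L`
(`Cubic.discr_eq_prod_three_roots`), and `φ δ = δ` for the even permutations, `φ δ = -δ` for the
transpositions; so `discr P` is a square in `K` exactly in the first two cases (in the third a square root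
`c ∈ K` would give `a²δ = ±c` fixed by `φ`, forcing `2δ = 0`, i.e. `δ = 0` in odd characteristic).

## References

* [Swan1962] R. G. Swan, *Factorization of polynomials over finite fields*, Pacific J. Math. 12 (1962)
  1099–1106, Corollary 1 (Stickelberger's theorem).
* L. Stickelberger, *Über eine neue Eigenschaft der Diskriminanten algebraischer Zahlkörper*, Verh. 1.
  Internat. Math.-Kongress Zürich 1897, 182–193.
* [LidlNiederreiter1996] R. Lidl, H. Niederreiter, *Finite Fields*, Thm. 2.14 / Thm. 2.21 (roots of an
  irreducible polynomial are the Frobenius conjugates; `Gal(𝔽_{q^m}/𝔽_q)` is generated by Frobenius).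
-/

noncomputable section

open Polynomial

namespace Literature.FieldTheory.FiniteFields.CubicDiscriminantRootParity

/-! ## §1. Frobenius-fixed elements of a finite extension lie in the base field

This is the tree's `Literature.FieldTheory.FiniteFields.GaussPeriodNormalBases.mem_range_algebraMap_of_pow_card_eq`
(`x ^ #K = x → x ∈ K`), imported. -/

open Literature.FieldTheory.FiniteFields.GaussPeriodNormalBases (mem_range_algebraMap_of_pow_card_eq)

/-! ## §2. Permutations of three letters -/

/-- An injective self-map preserving three distinct letters `x, y, z` is one of the six permutations:
the identity, one of the two `3`-cycles, or one of the three transpositions. [folklore] -/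
private theorem perm_three_cases {α : Type*} {σ : α → α} (hσ : Function.Injective σ) {x y z : α}
    (hxy : x ≠ y) (hxz : x ≠ z) (hyz : y ≠ z)
    (hx : σ x = x ∨ σ x = y ∨ σ x = z) (hy : σ y = x ∨ σ y = y ∨ σ y = z)
    (hz : σ z = x ∨ σ z = y ∨ σ z = z) :
    (σ x = x ∧ σ y = y ∧ σ z = z) ∨ (σ x = y ∧ σ y = z ∧ σ z = x) ∨ (σ x = z ∧ σ y = x ∧ σ z = y) ∨
      (σ x = x ∧ σ y = z ∧ σ z = y) ∨ (σ x = z ∧ σ y = y ∧ σ z = x) ∨ (σ x = y ∧ σ y = x ∧ σ z = z) := by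
  rcases hx with hx | hx | hx <;> rcases hy with hy | hy | hy <;> rcases hz with hz | hz | hz <;>
    first
    | exact Or.inl ⟨hx, hy, hz⟩
    | exact Or.inr (Or.inl ⟨hx, hy, hz⟩)
    | exact Or.inr (Or.inr (Or.inl ⟨hx, hy, hz⟩))
    | exact Or.inr (Or.inr (Or.inr (Or.inl ⟨hx, hy, hz⟩)))
    | exact Or.inr (Or.inr (Or.inr (Or.inr (Or.inl ⟨hx, hy, hz⟩))))
    | exact Or.inr (Or.inr (Or.inr (Or.inr (Or.inr ⟨hx, hy, hz⟩))))
    | exact absurd (hσ (hx.trans hy.symm)) hxy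
    | exact absurd (hσ (hx.trans hz.symm)) hxz
    | exact absurd (hσ (hy.trans hz.symm)) hyz

/-! ## §3. The root count of a cubic over a finite field -/

section Cubic

variable {K : Type*} [Field K] [Fintype K] [DecidableEq K]

omit [Fintype K] in
/-- The roots of a nonzero polynomial as a subtype: `#{x // p(x) = 0} = #(roots p).toFinset`. [folklore] -/
private theorem natCard_rootSet_eq_card_roots {p : K[X]} (hp : p ≠ 0) :
    Nat.card {x : K // p.eval x = 0} = p.roots.toFinset.card := by
  have e : {x : K // p.eval x = 0} ≃ {x : K // x ∈ p.roots.toFinset} :=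
    Equiv.subtypeEquivRight fun x => by rw [Multiset.mem_toFinset, mem_roots hp, IsRoot.def]
  rw [Nat.card_congr e, Nat.card_eq_fintype_card, Fintype.card_coe]

/-- **The key computation** (over a given finite extension `L ⊇ K` in which the cubic splits): for a cubic
`P` over a finite field `K` of odd characteristic with `P.a ≠ 0`, `discr P ≠ 0` and roots `x, y, z ∈ L`,
the number of roots of `P` in `K` is `0`, `1` or `3`, and it is `1` iff `discr P` is not a square in `K`
(Frobenius permutes `{x, y, z}`; `δ = (x-y)(x-z)(y-z)` is fixed by the even permutations and negated by
the transpositions; `discr P = (a²δ)²`). [cite: Swan1962, Corollary 1] -/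
theorem card_roots_trichotomy_of_roots_eq {L : Type*} [Field L] [Algebra K L] [Finite L]
    {P : Cubic K} (ha : P.a ≠ 0) (hd : P.discr ≠ 0) {x y z : L}
    (h3 : (Cubic.map (algebraMap K L) P).roots = {x, y, z}) :
    (P.toPoly.roots.toFinset.card = 0 ∨ P.toPoly.roots.toFinset.card = 1 ∨
        P.toPoly.roots.toFinset.card = 3) ∧
      ((2 : K) ≠ 0 → (P.toPoly.roots.toFinset.card = 1 ↔ ¬ IsSquare P.discr)) := by
  classical
  haveI : Module.Finite K L := Module.Finite.of_finite
  haveI : Algebra.IsAlgebraic K L := Algebra.IsAlgebraic.of_finite K L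
  set ι := algebraMap K L with hι
  set φ := FiniteField.frobeniusAlgEquivOfAlgebraic K L with hφdef
  -- the three roots are distinct
  obtain ⟨hxy, hxz, hyz⟩ := (Cubic.discr_ne_zero_iff_roots_ne ha h3).mp hd
  have h0 : P.toPoly ≠ 0 := Cubic.ne_zero_of_a_ne_zero ha
  have hmap0 : P.toPoly.map ι ≠ 0 := Polynomial.map_ne_zero h0
  -- membership in `{x, y, z}` is being a root in `L`
  have hR : ∀ r : L, (r = x ∨ r = y ∨ r = z) ↔ aeval r P.toPoly = 0 := by
    intro r
    have hm : r ∈ (Cubic.map ι P).roots ↔ aeval r P.toPoly = 0 := by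
      rw [Cubic.map_roots, mem_roots hmap0, IsRoot.def, eval_map_algebraMap]
    rw [← hm, h3]
    simp only [Multiset.insert_eq_cons, Multiset.mem_cons, Multiset.mem_singleton]
  -- Frobenius permutes the roots
  have hperm : ∀ r : L, (r = x ∨ r = y ∨ r = z) → (φ r = x ∨ φ r = y ∨ φ r = z) := by
    intro r hr
    rw [hR] at hr ⊢
    rw [show φ r = (φ : L →ₐ[K] L) r from rfl, Polynomial.aeval_algHom_apply, hr, map_zero]
  -- an element of `L` is fixed by Frobenius iff it comes from `K`
  have hfix : ∀ r : L, φ r = r ↔ r ∈ Set.range ι := by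
    intro r
    constructor
    · intro h
      apply mem_range_algebraMap_of_pow_card_eq (K := K)
      have h' := h
      rw [hφdef, FiniteField.coe_frobeniusAlgEquivOfAlgebraic] at h'
      exact h'
    · rintro ⟨s, rfl⟩
      exact φ.commutes s
  -- the number of `K`-roots is the number of Frobenius-fixed roots
  have hN : P.toPoly.roots.toFinset.card =
      (({x, y, z} : Finset L).filter fun r => φ r = r).card := by
    rw [← Finset.card_image_of_injective _ ι.injective]
    congr 1
    ext r
    simp only [Finset.mem_image, Multiset.mem_toFinset, mem_roots h0, IsRoot.def, Finset.mem_filter,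
      Finset.mem_insert, Finset.mem_singleton]
    constructor
    · rintro ⟨s, hs, rfl⟩
      refine ⟨(hR _).mpr ?_, φ.commutes s⟩
      rw [aeval_algebraMap_apply_eq_algebraMap_eval, hs, map_zero]
    · rintro ⟨hr, hφr⟩
      obtain ⟨s, rfl⟩ := (hfix _).mp hφr
      refine ⟨s, ?_, rfl⟩
      have := (hR _).mp hr
      rwa [aeval_algebraMap_apply_eq_algebraMap_eval, map_eq_zero_iff _ ι.injective] at this
  -- the discriminant in `L`
  set δ : L := (x - y) * (x - z) * (y - z) with hδ
  have hδ0 : δ ≠ 0 := by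
    simp only [hδ]
    exact mul_ne_zero (mul_ne_zero (sub_ne_zero.mpr hxy) (sub_ne_zero.mpr hxz)) (sub_ne_zero.mpr hyz)
  have hdisc : ι P.discr = (ι P.a * ι P.a * δ) ^ 2 := by
    rw [Cubic.discr_eq_prod_three_roots ha h3, hδ]; ring
  have ha' : ι P.a ≠ 0 := (map_ne_zero_iff _ ι.injective).mpr ha
  have h2' : (2 : K) ≠ 0 → (2 : L) ≠ 0 := fun h2 => by
    rw [← map_ofNat ι 2]; exact (map_ne_zero_iff _ ι.injective).mpr h2
  -- `φ δ = δ` gives a square, `φ δ = -δ` a non-square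
  have hsq_of_fix : φ δ = δ → IsSquare P.discr := by
    intro h
    obtain ⟨d, hd'⟩ := (hfix δ).mp h
    refine ⟨P.a * P.a * d, ι.injective ?_⟩
    rw [hdisc, map_mul, ← hd', sq, map_mul, map_mul]
  have hnsq_of_neg : φ δ = -δ → (2 : K) ≠ 0 → ¬ IsSquare P.discr := by
    rintro h h2 ⟨c, hc⟩
    have hc' : (ι c) ^ 2 = (ι P.a * ι P.a * δ) ^ 2 := by
      rw [← hdisc, hc, map_mul, sq]
    have hfixc : φ (ι P.a * ι P.a * δ) = ι P.a * ι P.a * δ := by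
      rcases sq_eq_sq_iff_eq_or_eq_neg.mp hc' with e | e
      · rw [← e]; exact φ.commutes c
      · have e' : ι P.a * ι P.a * δ = ι (-c) := by rw [map_neg, e, neg_neg]
        rw [e']; exact φ.commutes (-c)
    have : ι P.a * ι P.a * δ = -(ι P.a * ι P.a * δ) := by
      conv_lhs => rw [← hfixc]
      rw [map_mul, map_mul, φ.commutes, h, mul_neg]
    have h2δ : (2 : L) * (ι P.a * ι P.a * δ) = 0 := by
      rw [two_mul]; nth_rewrite 2 [this]; exact add_neg_cancel _
    rcases mul_eq_zero.mp h2δ with e | e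
    · exact h2' h2 e
    · exact mul_ne_zero (mul_ne_zero ha' ha') hδ0 e
  -- case analysis on the permutation induced by Frobenius
  have hcases := perm_three_cases φ.injective hxy hxz hyz (hperm x (Or.inl rfl))
    (hperm y (Or.inr (Or.inl rfl))) (hperm z (Or.inr (Or.inr rfl)))
  have hφδ : φ δ = (φ x - φ y) * (φ x - φ z) * (φ y - φ z) := by
    simp only [hδ, map_mul, map_sub]
  rw [hN]
  rcases hcases with ⟨ex, ey, ez⟩ | ⟨ex, ey, ez⟩ | ⟨ex, ey, ez⟩ | ⟨ex, ey, ez⟩ | ⟨ex, ey, ez⟩ |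
      ⟨ex, ey, ez⟩
  · -- identity: three rational roots, square discriminant
    have hc : (({x, y, z} : Finset L).filter fun r => φ r = r).card = 3 := by
      rw [Finset.filter_true_of_mem]
      · rw [Finset.card_insert_of_notMem (by simp [hxy, hxz]), Finset.card_insert_of_notMem (by simp [hyz]),
          Finset.card_singleton]
      · intro r hr
        simp only [Finset.mem_insert, Finset.mem_singleton] at hr
        rcases hr with rfl | rfl | rfl <;> assumption
    have hsq : IsSquare P.discr := hsq_of_fix (by rw [hφδ, ex, ey, ez])
    refine ⟨by omega, fun _ => ?_⟩
    rw [hc]; simp [hsq]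
  · -- 3-cycle `x ↦ y ↦ z ↦ x`: no rational root, square discriminant
    have hc : (({x, y, z} : Finset L).filter fun r => φ r = r).card = 0 := by
      rw [Finset.card_eq_zero, Finset.filter_eq_empty_iff]
      intro r hr
      simp only [Finset.mem_insert, Finset.mem_singleton] at hr
      rcases hr with rfl | rfl | rfl
      · rw [ex]; exact fun h => hxy h.symm
      · rw [ey]; exact fun h => hyz h.symm
      · rw [ez]; exact hxz
    have hsq : IsSquare P.discr := hsq_of_fix (by rw [hφδ, ex, ey, ez, hδ]; ring)
    refine ⟨by omega, fun _ => ?_⟩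
    rw [hc]; simp [hsq]
  · -- 3-cycle `x ↦ z ↦ y ↦ x`: no rational root, square discriminant
    have hc : (({x, y, z} : Finset L).filter fun r => φ r = r).card = 0 := by
      rw [Finset.card_eq_zero, Finset.filter_eq_empty_iff]
      intro r hr
      simp only [Finset.mem_insert, Finset.mem_singleton] at hr
      rcases hr with rfl | rfl | rfl
      · rw [ex]; exact fun h => hxz h.symm
      · rw [ey]; exact hxy
      · rw [ez]; exact hyz
    have hsq : IsSquare P.discr := hsq_of_fix (by rw [hφδ, ex, ey, ez, hδ]; ring)
    refine ⟨by omega, fun _ => ?_⟩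
    rw [hc]; simp [hsq]
  · -- transposition `(y z)`: one rational root, non-square discriminant
    have hc : (({x, y, z} : Finset L).filter fun r => φ r = r).card = 1 := by
      rw [Finset.card_eq_one]
      refine ⟨x, ?_⟩
      ext r
      simp only [Finset.mem_filter, Finset.mem_insert, Finset.mem_singleton]
      constructor
      · rintro ⟨hr, h⟩
        rcases hr with rfl | rfl | rfl
        · rfl
        · rw [ey] at h; exact absurd h.symm hyz
        · rw [ez] at h; exact absurd h hyz
      · rintro rfl; exact ⟨Or.inl rfl, ex⟩
    refine ⟨by omega, fun h2 => ?_⟩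
    have hnsq : ¬ IsSquare P.discr := hnsq_of_neg (by rw [hφδ, ex, ey, ez, hδ]; ring) h2
    rw [hc]; simp [hnsq]
  · -- transposition `(x z)`: one rational root, non-square discriminant
    have hc : (({x, y, z} : Finset L).filter fun r => φ r = r).card = 1 := by
      rw [Finset.card_eq_one]
      refine ⟨y, ?_⟩
      ext r
      simp only [Finset.mem_filter, Finset.mem_insert, Finset.mem_singleton]
      constructor
      · rintro ⟨hr, h⟩
        rcases hr with rfl | rfl | rfl
        · rw [ex] at h; exact absurd h.symm hxz
        · rfl
        · rw [ez] at h; exact absurd h hxz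
      · rintro rfl; exact ⟨Or.inr (Or.inl rfl), ey⟩
    refine ⟨by omega, fun h2 => ?_⟩
    have hnsq : ¬ IsSquare P.discr := hnsq_of_neg (by rw [hφδ, ex, ey, ez, hδ]; ring) h2
    rw [hc]; simp [hnsq]
  · -- transposition `(x y)`: one rational root, non-square discriminant
    have hc : (({x, y, z} : Finset L).filter fun r => φ r = r).card = 1 := by
      rw [Finset.card_eq_one]
      refine ⟨z, ?_⟩
      ext r
      simp only [Finset.mem_filter, Finset.mem_insert, Finset.mem_singleton]
      constructor
      · rintro ⟨hr, h⟩
        rcases hr with rfl | rfl | rfl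
        · rw [ex] at h; exact absurd h.symm hxy
        · rw [ey] at h; exact absurd h hxy
        · rfl
      · rintro rfl; exact ⟨Or.inr (Or.inr rfl), ez⟩
    refine ⟨by omega, fun h2 => ?_⟩
    have hnsq : ¬ IsSquare P.discr := hnsq_of_neg (by rw [hφδ, ex, ey, ez, hδ]; ring) h2
    rw [hc]; simp [hnsq]

/-- A cubic over a finite field with nonzero leading coefficient and nonzero discriminant has `0`, `1` or
`3` roots in the field (never `2`: Frobenius permutes the three roots in a splitting field).
[cite: Swan1962, Corollary 1] -/
theorem card_roots_eq_zero_or_one_or_three {P : Cubic K} (ha : P.a ≠ 0) (hd : P.discr ≠ 0) :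
    P.toPoly.roots.toFinset.card = 0 ∨ P.toPoly.roots.toFinset.card = 1 ∨
      P.toPoly.roots.toFinset.card = 3 := by
  haveI : Finite P.toPoly.SplittingField := Module.finite_of_finite K
  obtain ⟨x, y, z, h3⟩ :=
    (Cubic.splits_iff_roots_eq_three ha).mp (SplittingField.splits P.toPoly)
  exact (card_roots_trichotomy_of_roots_eq ha hd h3).1

/-- **Stickelberger's parity theorem for cubics over a finite field of odd characteristic**: a cubic `P`
with `P.a ≠ 0` and `discr P ≠ 0` over a finite field `K` with `2 ≠ 0` has EXACTLY ONE root in `K` iff its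
discriminant is not a square in `K`. [cite: Swan1962, Corollary 1] -/
theorem card_roots_eq_one_iff_not_isSquare_discr (h2 : (2 : K) ≠ 0) {P : Cubic K} (ha : P.a ≠ 0)
    (hd : P.discr ≠ 0) : P.toPoly.roots.toFinset.card = 1 ↔ ¬ IsSquare P.discr := by
  haveI : Finite P.toPoly.SplittingField := Module.finite_of_finite K
  obtain ⟨x, y, z, h3⟩ :=
    (Cubic.splits_iff_roots_eq_three ha).mp (SplittingField.splits P.toPoly)
  exact (card_roots_trichotomy_of_roots_eq ha hd h3).2 h2

/-- Equivalently: the discriminant is a square iff the number of roots is `0` or `3`.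
[cite: Swan1962, Corollary 1] -/
theorem isSquare_discr_iff_card_roots (h2 : (2 : K) ≠ 0) {P : Cubic K} (ha : P.a ≠ 0)
    (hd : P.discr ≠ 0) :
    IsSquare P.discr ↔ P.toPoly.roots.toFinset.card = 0 ∨ P.toPoly.roots.toFinset.card = 3 := by
  have h := card_roots_eq_one_iff_not_isSquare_discr h2 ha hd
  rcases card_roots_eq_zero_or_one_or_three ha hd with h0 | h1 | h3 <;> simp_all

/-- `Nat.card` form: the set of roots `{x // P(x) = 0}` has exactly one element iff `discr P` is a
non-square. [cite: Swan1962, Corollary 1] -/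
theorem natCard_roots_eq_one_iff_not_isSquare_discr (h2 : (2 : K) ≠ 0) {P : Cubic K} (ha : P.a ≠ 0)
    (hd : P.discr ≠ 0) : Nat.card {x : K // P.toPoly.eval x = 0} = 1 ↔ ¬ IsSquare P.discr := by
  rw [natCard_rootSet_eq_card_roots (Cubic.ne_zero_of_a_ne_zero ha)]
  exact card_roots_eq_one_iff_not_isSquare_discr h2 ha hd

/-- The arithmetic of `log₂`: for `c ∈ {0, 1, 3}`, `log₂ (c + 1) ∈ {0, 1, 2}` is odd iff `c = 1`. [folklore] -/
private theorem log_two_add_one_mod_two_eq_one_iff {c : ℕ} (hc : c = 0 ∨ c = 1 ∨ c = 3) :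
    Nat.log 2 (c + 1) % 2 = 1 ↔ c = 1 := by
  have hl2 : Nat.log 2 2 = 1 := by simpa using Nat.log_pow (b := 2) one_lt_two 1
  have hl4 : Nat.log 2 4 = 2 := by simpa using Nat.log_pow (b := 2) one_lt_two 2
  rcases hc with rfl | rfl | rfl
  · simp
  · simp [hl2]
  · simp [hl4]

/-- **The local `2`-torsion dimension parity**: `log₂ (1 + #{x ∈ K // P(x) = 0})` — for the `2`-division
cubic of an elliptic curve over `K = 𝔽_ℓ` this is `dim_{𝔽₂} E(𝔽_ℓ)[2] ∈ {0, 1, 2}` — is ODD iff `discr P`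
is a non-square in `K`. [cite: Swan1962, Corollary 1] -/
theorem log_two_natCard_roots_add_one_mod_two_eq_one_iff (h2 : (2 : K) ≠ 0) {P : Cubic K}
    (ha : P.a ≠ 0) (hd : P.discr ≠ 0) :
    Nat.log 2 (Nat.card {x : K // P.toPoly.eval x = 0} + 1) % 2 = 1 ↔ ¬ IsSquare P.discr := by
  have h0 := Cubic.ne_zero_of_a_ne_zero ha
  rw [log_two_add_one_mod_two_eq_one_iff
      (by rw [natCard_rootSet_eq_card_roots h0]; exact card_roots_eq_zero_or_one_or_three ha hd)]
  exact natCard_roots_eq_one_iff_not_isSquare_discr h2 ha hd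

omit [Fintype K] [DecidableEq K] in
/-- Scaling by a nonzero square does not change squareness (in a field). [folklore] -/
private theorem isSquare_mul_sq_iff {c d : K} (hc : c ≠ 0) : IsSquare (c ^ 2 * d) ↔ IsSquare d := by
  constructor
  · rintro ⟨s, hs⟩
    refine ⟨s / c, ?_⟩
    field_simp
    rw [mul_comm, hs]; ring
  · rintro ⟨s, hs⟩
    exact ⟨c * s, by rw [hs]; ring⟩

/-- **The `2`-division cubic of a Weierstrass equation over a finite field of odd characteristic**
(`4x³ + b₂x² + 2b₄x + b₆`, discriminant `16 Δ`, Mathlib `WeierstrassCurve.twoTorsionPolynomial_discr`):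
for `Δ ≠ 0`, the parity of `log₂ (1 + #roots in K)` (`= dim_{𝔽₂} E(K)[2]`) is `1` iff `Δ` is a
non-square in `K`. This is the form used for the local `2`-torsion of elliptic curves over `ℚ` at odd primes
of good reduction (Kramer 1981, Prop. 3: the local norm index `i_ℓ`). [cite: Swan1962, Corollary 1] -/
theorem _root_.WeierstrassCurve.log_two_natCard_twoTorsionPolynomial_roots_add_one_mod_two_eq_one_iff
    (W : WeierstrassCurve K) (h2 : (2 : K) ≠ 0) (hΔ : W.Δ ≠ 0) :
    Nat.log 2 (Nat.card {x : K // W.twoTorsionPolynomial.toPoly.eval x = 0} + 1) % 2 = 1 ↔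
      ¬ IsSquare W.Δ := by
  have ha : W.twoTorsionPolynomial.a ≠ 0 := by
    change (4 : K) ≠ 0
    have : (4 : K) = 2 ^ 2 := by norm_num
    rw [this]; exact pow_ne_zero 2 h2
  have h16 : (16 : K) = 4 ^ 2 := by norm_num
  have h4 : (4 : K) ≠ 0 := ha
  have hd : W.twoTorsionPolynomial.discr ≠ 0 := by
    rw [WeierstrassCurve.twoTorsionPolynomial_discr, h16]
    exact mul_ne_zero (pow_ne_zero 2 h4) hΔ
  rw [log_two_natCard_roots_add_one_mod_two_eq_one_iff h2 ha hd, WeierstrassCurve.twoTorsionPolynomial_discr,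
    h16, isSquare_mul_sq_iff h4]

end Cubic

end Literature.FieldTheory.FiniteFields.CubicDiscriminantRootParity

end
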